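import Summits.NavierStokesRegularity.NavierStokesRegularity.Theses.ExtremiserTransience
import Summits.NavierStokesRegularity.NavierStokesRegularity.Theses.ThreadingFlux
import Summits.NavierStokesRegularity.NavierStokesRegularity.Theorems.ExtremiserTransienceAveragedRungSlab
import Summits.NavierStokesRegularity.NavierStokesRegularity.Theorems.TypeICertificateLadderTargetStrainCubeCeiling
import HarnessLib

/-!
# Route `ExtremiserTransience`, support item `AveragedRung` (stmt-NavierStokesRegularity-21885):
# THE MEAN-FORM RUNG — a log-time quadratic-mean depletion coefficient `r` with `r·C < 1` excludes
# Type-I blow-up at dimensionless rate `C`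

`--workitem stmt-NavierStokesRegularity-21885` (route `ExtremiserTransience`, D-0145 ideator line of the
LADDER-NS hard core N0 / stmt-1217 `ThreadingFlux.Target`; director-ns 2026-08-27T17:57Z «ceiling_lift = a
NON-constant-form input»). Author: the STA lineage `ns-sta-19551-p1` (g10). Slab step:
`…ExtremiserTransienceAveragedRungSlab.lean` (`lintegral_curl_sq_le_rpow_of_rate_logMean`).

* `DepletionLadder.energy_add_enstrophy_le_rpow_of_rate_logMean` — `‖u‖₂² + ‖∇u‖₂² ≤ K′(T−t)^{−r²C²/2}` on
  `[T/2, T)` under the log-mean hypothesis.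
* `DepletionLadder.rung_of_logMeanDepletion` — **the mean-form rung**: `0 ≤ r`, `0 < C`, `rC < 1`, eventual rate
  `C`, measurable flow-wise coefficient `k ∈ [0,1]` with `∫_{t₁}^t k² dτ/(T−τ) ≤ r² log((T−t₁)/(T−t)) + B` ⇒
  the solution extends smoothly past `T` (exponent `r²C²/2 < 1/2` against Leray's `H¹` rate,
  `hasSmoothExtensionPast_of_powerRate`). The constant case `k ≡ κ` is the landed `rung_of_eventualDepletion`.
* `extremiserTransience_averagedRung_proof : Theses.ExtremiserTransience.AveragedRung` — the item, by name.
* `rung_of_nearExtremalTransience` — what the attacked crux buys on the landed chain ALONE (no `DepletionCascade`):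
  `NearExtremalTransience` ⇒ `∃ θ < 1` such that `X_C` holds for every `C > 0` with `θ·((2+√3)/9)·C < 1`, i.e.
  the kernel reach moves from `18 − 9√3 ≈ 2.41` (`StrainCube.rung_of_le_sharp`) to `(18 − 9√3)/θ` — beyond
  every landed rung, and beyond the constant-form CEILING `200/13` (`StrainCube.constantForm_rung_ceiling_S5`)
  iff `θ < 13(18−9√3)/200 ≈ 0.157`. The `κ`-premise of the crux is met by `κ = (2+√3)/9`
  (`StrainCube.sharp_constant_is_universal`), which is how the proof instantiates it: the crux is not vacuous
  in `κ` (idea-crit-3 P3, 2026-08-27T21:01Z), and every admissible `κ` exceeds `13/200`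
  (`StrainCube.universal_depletion_constant_gt_S5`).
* `nearExtremalTransience_of_target`, `depletionCascade_of_target` — certificates that both new cruxes of the
  route are implied by the hard core stmt-1217 (`ThreadingFlux.Target`), vacuously (a Type-I-rate solution
  that does not extend contradicts `Target`): the route is a LINE of 1217, its cruxes are not stronger than it.

WHAT THIS IS NOT: no depletion (constant or mean) is proved; nothing about Type II; `NearExtremalTransience`
(stmt-21883) and `DepletionCascade` (stmt-21884) stay open. The energy class is load-bearing through
`RungReynoldsOne.stub_h1BlowupRate`. References: Leray 1934 §§19–20; Lemarié-Rieusset (2016), Thm. 11.2;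
Robinson–Rodrigo–Sadowski (2016), Lemma 8.16; T. Tao, arXiv:1108.1165, Thm. 5.4. [folklore]
-/

noncomputable section

open Set Filter Topology MeasureTheory
open scoped RealInnerProductSpace ENNReal NNReal ContDiff
open Literature.Analysis.FluidPDE

namespace Summit.NavierStokesRegularity.NavierStokesRegularity.Theorems

-- the problem directory repeats the summit name (`NavierStokesRegularity/NavierStokesRegularity`)
set_option linter.dupNamespace false

namespace DepletionLadder

open Summit.NavierStokesRegularity.NavierStokesRegularity.Theorems.RungReynoldsOne

/-- **The `H¹`-type power rate under rate `C` and a log-mean depletion coefficient `r`:** in the setting of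
`lintegral_curl_sq_le_rpow_of_rate_logMean`, `‖u(t)‖₂² + ‖∇u(t)‖₂² ≤ K′(T−t)^{−r²C²/2}` on `[T/2, T)`
(energy `≤ 2E(u₀)` by `IsLerayHopfOn.lintegral_enorm_sq_le`, `∫|∇u|² ≤ ∫|curl u|²` by
`lintegral_frobeniusNormSq_fderiv_le_lintegral_sq_norm_curl`). [folklore] -/
theorem energy_add_enstrophy_le_rpow_of_rate_logMean {ν r T C t₁ B : ℝ} (hν : 0 < ν) (hT : 0 < T)
    (ht₁ : t₁ ∈ Ico 0 T)
    {u : ℝ → EuclideanSpace ℝ (Fin 3) → EuclideanSpace ℝ (Fin 3)}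
    {p : ℝ → EuclideanSpace ℝ (Fin 3) → ℝ}
    (hsol : IsClassicalNSSolutionOn (Ico 0 T) ν 0 u p) (hLH : IsLerayHopfOn T ν 0 (u 0) u)
    (hdec : HasRapidSpatialDecay (u 0))
    {k : ℝ → ℝ} (hkm : Measurable k) (hk01 : ∀ τ, 0 ≤ k τ ∧ k τ ≤ 1)
    (hflow : ∀ t ∈ Ico t₁ T, ∀ M : ℝ, (∀ x, ‖u t x‖ ≤ M) →
      |∫ x, ⟪curl (u t) x, fderiv ℝ (u t) x (curl (u t) x)⟫| ≤
        k t * M * Real.sqrt (∫ x, ‖curl (u t) x‖ ^ 2) *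
          Real.sqrt (∫ x, frobeniusNormSq (fderiv ℝ (curl (u t)) x)))
    (hmean : ∀ t ∈ Ico t₁ T, ∫ τ in t₁..t, k τ ^ 2 / (T - τ) ≤
      r ^ 2 * Real.log ((T - t₁) / (T - t)) + B)
    (hrate : ∀ᶠ t in 𝓝[<] T, ∀ x, Real.sqrt (T - t) * ‖u t x‖ ≤ C * Real.sqrt ν) :
    ∃ K : ℝ, ∃ t₀ ∈ Ico 0 T, ∀ t ∈ Ico t₀ T,
      (∫⁻ x, ‖u t x‖ₑ ^ 2) + ∫⁻ x, ENNReal.ofReal (frobeniusNormSq (fderiv ℝ (u t) x)) ≤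
        ENNReal.ofReal (K * (T - t) ^ (-(r ^ 2 * C ^ 2 / 2))) := by
  obtain ⟨K, hK0, hK⟩ := lintegral_curl_sq_le_rpow_of_rate_logMean hν hT ht₁ hsol hLH hdec hkm hk01
    hflow hmean hrate
  set γ : ℝ := r ^ 2 * C ^ 2 / 2 with hγ
  have hγ0 : 0 ≤ γ := by positivity
  set E₀ : ℝ := 2 * VectorCalculus.kineticEnergy (u 0) with hE₀
  have hE : ∀ t ∈ Icc 0 T, ∫⁻ x, ‖u t x‖ₑ ^ 2 ≤ ENNReal.ofReal (max E₀ 0) := fun t ht =>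
    (hLH.lintegral_enorm_sq_le hν.le ht).trans (ENNReal.ofReal_le_ofReal (le_max_left _ _))
  refine ⟨max E₀ 0 * T ^ γ + K, T / 2, ⟨by positivity, by linarith⟩, fun t ht => ?_⟩
  have ht' : t ∈ Ioo 0 T := ⟨lt_of_lt_of_le (by positivity) ht.1, ht.2⟩
  have htc : t ∈ Icc 0 T := ⟨ht'.1.le, ht'.2.le⟩
  have htI : t ∈ Ico 0 T := ⟨ht'.1.le, ht'.2⟩
  have hTt : 0 < T - t := sub_pos.2 ht.2
  have hL2 : ∫⁻ x, ‖u t x‖ₑ ^ 2 < ⊤ := (hE t htc).trans_lt ENNReal.ofReal_lt_top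
  have hG : ∫⁻ x, ENNReal.ofReal (frobeniusNormSq (fderiv ℝ (u t) x)) ≤ ∫⁻ x, ‖curl (u t) x‖ₑ ^ 2 :=
    lintegral_frobeniusNormSq_fderiv_le_lintegral_sq_norm_curl
      ((hsol.contDiff_velocity htI).of_le (by norm_cast)) (hsol.divFree t htI) hL2
  have hone : 1 ≤ T ^ γ * (T - t) ^ (-γ) := by
    rw [Real.rpow_neg hTt.le, ← div_eq_mul_inv, ← Real.div_rpow hT.le hTt.le]
    exact Real.one_le_rpow ((one_le_div hTt).2 (by linarith [ht'.1])) hγ0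
  have hE' : max E₀ 0 ≤ max E₀ 0 * T ^ γ * (T - t) ^ (-γ) := by
    have := mul_le_mul_of_nonneg_left hone (le_max_right E₀ 0)
    rw [mul_one] at this
    simpa [mul_assoc] using this
  calc (∫⁻ x, ‖u t x‖ₑ ^ 2) + ∫⁻ x, ENNReal.ofReal (frobeniusNormSq (fderiv ℝ (u t) x))
      ≤ ENNReal.ofReal (max E₀ 0) + ENNReal.ofReal (K * (T - t) ^ (-γ)) :=
        add_le_add (hE t htc) (hG.trans (hK t ht'))
    _ = ENNReal.ofReal (max E₀ 0 + K * (T - t) ^ (-γ)) :=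
        (ENNReal.ofReal_add (le_max_right _ _) (by positivity)).symm
    _ ≤ ENNReal.ofReal ((max E₀ 0 * T ^ γ + K) * (T - t) ^ (-γ)) := by
        refine ENNReal.ofReal_le_ofReal ?_
        rw [add_mul]
        exact add_le_add hE' le_rfl

/-- **THE MEAN-FORM RUNG.** Let `u` be a classical solution of the unforced Navier–Stokes system on
`ℝ³ × [0,T)` (`ν, T > 0`), Leray–Hopf from its rapidly decaying datum, with eventual dimensionless rate
`√(T−t)‖u(t,x)‖ ≤ C√ν`, `C > 0`. If for some `r ≥ 0` with `r·C < 1` the solution admits, from some onset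
`t₁ ∈ [0,T)`, a measurable flow-wise depletion coefficient `k : ℝ → [0,1]`
(`|∫⟪ω(t), Du(t) ω(t)⟫| ≤ k(t)·M·‖ω(t)‖₂·‖∇ω(t)‖₂` for every bound `M` of `|u(t)|`, `t ∈ [t₁,T)`) with
log-time quadratic mean at most `r` (`∫_{t₁}^t k(τ)² dτ/(T−τ) ≤ r² log((T−t₁)/(T−t)) + B` on `[t₁,T)`), then `u`
extends smoothly past `T` (enstrophy exponent `r²C²/2 < 1/2` against Leray's `H¹` rate,
`hasSmoothExtensionPast_of_powerRate`). The constant case `k ≡ κ` is the landed `rung_of_eventualDepletion`.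
[folklore] -/
theorem rung_of_logMeanDepletion {ν r T C t₁ B : ℝ} (hν : 0 < ν) (hT : 0 < T) (hr : 0 ≤ r)
    (hC : 0 < C) (hrC : r * C < 1) (ht₁ : t₁ ∈ Ico 0 T)
    {u : ℝ → EuclideanSpace ℝ (Fin 3) → EuclideanSpace ℝ (Fin 3)}
    {p : ℝ → EuclideanSpace ℝ (Fin 3) → ℝ}
    (hsol : IsClassicalNSSolutionOn (Ico 0 T) ν 0 u p) (hLH : IsLerayHopfOn T ν 0 (u 0) u)
    (hdec : HasRapidSpatialDecay (u 0))
    {k : ℝ → ℝ} (hkm : Measurable k) (hk01 : ∀ τ, 0 ≤ k τ ∧ k τ ≤ 1)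
    (hflow : ∀ t ∈ Ico t₁ T, ∀ M : ℝ, (∀ x, ‖u t x‖ ≤ M) →
      |∫ x, ⟪curl (u t) x, fderiv ℝ (u t) x (curl (u t) x)⟫| ≤
        k t * M * Real.sqrt (∫ x, ‖curl (u t) x‖ ^ 2) *
          Real.sqrt (∫ x, frobeniusNormSq (fderiv ℝ (curl (u t)) x)))
    (hmean : ∀ t ∈ Ico t₁ T, ∫ τ in t₁..t, k τ ^ 2 / (T - τ) ≤
      r ^ 2 * Real.log ((T - t₁) / (T - t)) + B)
    (hrate : ∀ᶠ t in 𝓝[<] T, ∀ x, Real.sqrt (T - t) * ‖u t x‖ ≤ C * Real.sqrt ν) :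
    HasSmoothExtensionPast ν 0 u T := by
  have hγ : r ^ 2 * C ^ 2 / 2 < 1 / 2 := by
    have h0 : 0 ≤ r * C := mul_nonneg hr hC.le
    have h1 : (r * C) ^ 2 < 1 := by nlinarith
    rw [mul_pow] at h1
    linarith
  obtain ⟨K, t₀, ht₀, hK⟩ :=
    energy_add_enstrophy_le_rpow_of_rate_logMean hν hT ht₁ hsol hLH hdec hkm hk01 hflow hmean hrate
  exact hasSmoothExtensionPast_of_powerRate hν hT hγ hsol hLH hdec ⟨t₀, ht₀, hK⟩

end DepletionLadder

open DepletionLadder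

/-- **Support item `AveragedRung` of route `ExtremiserTransience` (stmt-NavierStokesRegularity-21885), BY
NAME**: the mean-form rung `DepletionLadder.rung_of_logMeanDepletion`, with the item's binders unpacked.
[folklore] -/
theorem extremiserTransience_averagedRung_proof :
    Summit.NavierStokesRegularity.NavierStokesRegularity.Theses.ExtremiserTransience.AveragedRung := by
  intro r C ν T hr hC hrC hν hT u p hsol hLH hdec hrate hk
  obtain ⟨t₁, ht₁, k, B, hkm, hk01, hflow, hmean⟩ := hk
  exact rung_of_logMeanDepletion hν hT hr hC hrC ht₁ hsol hLH hdec hkm hk01 hflow hmean hrate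

/-- **What the attacked crux buys on the landed chain alone.** If `NearExtremalTransience`
(stmt-NavierStokesRegularity-21883) holds, then there is `θ ∈ [0,1)` such that the Type-I exclusion `X_C`
holds for every dimensionless rate `C > 0` with `θ·((2+√3)/9)·C < 1`: every classical Leray–Hopf
rapidly-decaying-datum solution on `[0,T)` with eventual rate `√(T−t)‖u(t,x)‖ ≤ C√ν` extends smoothly past `T`.
The reach `(18 − 9√3)/θ` (`= ∞` if `θ = 0`) lies strictly beyond the landed constant-form reach
`18 − 9√3 ≈ 2.4115` (`StrainCube.rung_of_le_sharp`), and beyond the constant-form CEILING `200/13`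
(`StrainCube.constantForm_rung_ceiling_S5`) iff `θ < 13(18 − 9√3)/200 ≈ 0.157`. Proof: the `κ`-premise of the
crux is met by `κ = (2+√3)/9` (`StrainCube.sharp_constant_is_universal`), so a non-extending solution carries a
log-mean coefficient at level `r = θ(2+√3)/9`, and `rung_of_logMeanDepletion` extends it — contradiction. No
`DepletionCascade` is used. [folklore] -/
theorem rung_of_nearExtremalTransience
    (hNET : Summit.NavierStokesRegularity.NavierStokesRegularity.Theses.ExtremiserTransience.NearExtremalTransience) :
    ∃ θ : ℝ, 0 ≤ θ ∧ θ < 1 ∧ ∀ (C ν T : ℝ), 0 < C → θ * ((2 + Real.sqrt 3) / 9) * C < 1 → 0 < ν → 0 < T →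
      ∀ (u : ℝ → EuclideanSpace ℝ (Fin 3) → EuclideanSpace ℝ (Fin 3))
        (p : ℝ → EuclideanSpace ℝ (Fin 3) → ℝ),
        IsClassicalNSSolutionOn (Ico 0 T) ν 0 u p → IsLerayHopfOn T ν 0 (u 0) u →
        HasRapidSpatialDecay (u 0) →
        (∀ᶠ t in 𝓝[<] T, ∀ x, Real.sqrt (T - t) * ‖u t x‖ ≤ C * Real.sqrt ν) →
        HasSmoothExtensionPast ν 0 u T := by
  obtain ⟨θ, hθ0, hθ1, hθ⟩ := hNET
  refine ⟨θ, hθ0, hθ1, fun C ν T hC hθC hν hT u p hsol hLH hdec hrate => ?_⟩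
  by_contra hext
  have hκ := hθ ((2 + Real.sqrt 3) / 9) StrainCube.sharp_constant_is_universal C ν T hC hν hT u p hsol
    hLH hdec hrate hext
  obtain ⟨t₁, ht₁, k, B, hkm, hk01, hflow, hmean⟩ := hκ
  have hr : 0 ≤ θ * ((2 + Real.sqrt 3) / 9) := by positivity
  exact hext (rung_of_logMeanDepletion hν hT hr hC hθC ht₁ hsol hLH hdec hkm hk01 hflow hmean hrate)

/-- **Crux 2 of the route is implied by the hard core** (certificate that the line does not strengthen
stmt-1217): `ThreadingFlux.Target` (no Type-I blow-up for Clay data) gives `NearExtremalTransience` vacuously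
— under `Target` a classical Leray–Hopf rapidly-decaying-datum solution with eventual rate `C` DOES extend past
`T` (the rate is a Type-I bound `‖u(t,x)‖ ≤ C√ν/√(T−t)`), so the conclusion is never asked for (`θ = 0`).
[folklore] -/
theorem nearExtremalTransience_of_target
    (hX : Summit.NavierStokesRegularity.NavierStokesRegularity.Theses.ThreadingFlux.Target) :
    Summit.NavierStokesRegularity.NavierStokesRegularity.Theses.ExtremiserTransience.NearExtremalTransience := by
  refine ⟨0, le_rfl, zero_lt_one, fun κ _ C ν T _ hν hT u p hsol hLH hdec hrate hext => ?_⟩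
  exfalso
  refine hext (hX ν T hν hT u p hsol hLH hdec ⟨C * Real.sqrt ν, ?_⟩)
  filter_upwards [hrate, self_mem_nhdsWithin] with t ht htT
  intro x
  have hpos : 0 < Real.sqrt (T - t) := Real.sqrt_pos.2 (sub_pos.2 htT)
  rw [le_div_iff₀ hpos, mul_comm]
  exact ht x

/-- **Crux 3 (the declared RESIDUAL) is implied by the hard core**, as the route text says («implied by
stmt-1217 (vacuously)»): under `ThreadingFlux.Target` the hypothesis «does not extend past `T`» of
`DepletionCascade` is never met by a Type-I-rate solution. [folklore] -/
theorem depletionCascade_of_target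
    (hX : Summit.NavierStokesRegularity.NavierStokesRegularity.Theses.ThreadingFlux.Target) :
    Summit.NavierStokesRegularity.NavierStokesRegularity.Theses.ExtremiserTransience.DepletionCascade := by
  intro C ν T _ hν hT u p hsol hLH hdec hrate hext _ r _
  exfalso
  refine hext (hX ν T hν hT u p hsol hLH hdec ⟨C * Real.sqrt ν, ?_⟩)
  filter_upwards [hrate, self_mem_nhdsWithin] with t ht htT
  intro x
  have hpos : 0 < Real.sqrt (T - t) := Real.sqrt_pos.2 (sub_pos.2 htT)
  rw [le_div_iff₀ hpos, mul_comm]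
  exact ht x

end Summit.NavierStokesRegularity.NavierStokesRegularity.Theorems

end
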